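import Summits.ValiantsHypothesis.ValiantsHypothesis.Theorems.PolyaContinuedLaplaceRigiditySingGenericPoint
import Summits.ValiantsHypothesis.ValiantsHypothesis.Theorems.PolyaContinuedLaplaceRigiditySingCodimEight

/-!
# Top-dimensional components of `Sing(per₄)` with exactly one zero line, part 1: LEMMA A
# (the «K-core» of stub B-row of line `component_rigidity`, generic-point half)

Helper file for crux `CoverDecancellation` (stmt-ValiantsHypothesis-17819), line `laplace_rigidity`,
rung row R3 at width 4 (`str₂(per₄) ≥ 5`), read against val-idea-10 g3's line «component_rigidity»
(workfile v4: registered stub `stub_rowPrimeRigidity`).  After `…SingTopZeroLine` (a zero line) and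
`…SingTopLines` (a second zero line: types (L) and (X)), what is left of stub B-row is a height-`≤ 8`
prime `P` over the `3 × 3` sub-permanents containing the variables of row `i` and NO other full row or
column (Kirkup's non-degenerate component, `(x_{i·}) + J₃`); the analysis runs at a point `z` with
`ker (f ↦ f(z)) = P` — the generic point — with `u, v, r` its three other rows.

This is part 1, **LEMMA A** — the corank-`≥ 2` strata of the symmetric zero-diagonal `4 × 4` matrix
`M(u,v)` (`M_cd = per₂(u,v | [4] ∖ {c,d})`, six values `w_ab = u_a v_b + u_b v_a`), in the consumable
form «`trdeg_F F[u,v]` is small on them» (the card's «corank ≥ 2 only on loci of dimension ≤ 6»):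

* `trdeg_le_five_of_star` — the three `w_dx` through a column `d` vanish, `(u_d, v_d) ≠ 0` ⇒
  `trdeg_F F[u,v] ≤ 5`;
* `trdeg_le_five_of_matching` — `w_ce = w_df = 0` on a perfect matching, the block relation
  `w_ef w_cd = w_cf w_de`, non-zero rows and no zero column ⇒ `trdeg_F F[u,v] ≤ 5` (`2 ≠ 0`);
* `trdeg_le_three_of_perTwo_all` — all six `w_ab = 0`, both rows non-zero ⇒ `trdeg_F F[u,v] ≤ 3`.

At a pivot `M_cd ≠ 0` the kernel equations `M(u,v) r = 0` reduce to the Schur system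
`A r_e + B r_f = 0`, `B r_e + C r_f = 0`, `A = −2 M_ce M_de`, `C = −2 M_cf M_df`,
`B = M_cd M_ef − M_ce M_df − M_de M_cf`; `A = B = C = 0` is exactly STAR-or-MATCHING, so part 2
(`…SingKCoreLine`) gets the KERNEL LINE `trdeg_F F[z] ≤ trdeg_F F[u,v] + 1` and the octic
`det M(u,v) = 0` at the generic point; part 3 the non-vanishing of coordinates and binomials; the
GRADING half of val-idea-10's LEMMA B then closes stub B-row.  This part imports no matrices.

Honest framing: structure lemmas; `str₂(per₄) ≥ 5`, `StrengthTwoPerFour` (stmt-25160),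
`CentralLaplaceRigidity`, `CoverDecancellation`, VP ≠ VNP are OPEN and NOT moved; no summit statement is
touched.  val-width-17819-w1 g2, 2026-08-28.

References: G. Kirkup, *Minimal primes over permanental ideals*, Trans. AMS 360 (2008), Prop. 11 and
Thm. 14 [Kirkup2005]; A. Boralevi, E. Carlini, M. Michałek, E. Ventura, Adv. Math. 461 (2025),
Prop. 3.10 [BoraleviCarliniMichalekVentura2025].
-/

set_option linter.dupNamespace false

noncomputable section

namespace Summit.ValiantsHypothesis.ValiantsHypothesis.Theorems.PolyaContinuedLaplaceRigidity.SingCodim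

open MvPolynomial Cardinal
open Summit.ValiantsHypothesis.ValiantsHypothesis.Theorems.SymPencilPerFourHessianRankThreeZero (eq_or_of_four)
open Literature.Computability.AlgebraicComplexity
open Literature.Computability.AlgebraicComplexity.BoraleviCarliniMichalekVentura2025

variable {F : Type*} [Field F] {L : Type*} [Field L] [Algebra F L]

/-! ### LEMMA A: the corank-`≥ 2` strata of `M(u,v)` -/

section LemmaA

variable (u v : Fin 4 → L)

/-- Generators lie in the subalgebra of the two rows. -/
theorem u_mem_adjoin_rows (c : Fin 4) : u c ∈ Algebra.adjoin F (Set.range u ∪ Set.range v) :=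
  Algebra.subset_adjoin (Or.inl ⟨c, rfl⟩)

/-- Generators lie in the subalgebra of the two rows. -/
theorem v_mem_adjoin_rows (c : Fin 4) : v c ∈ Algebra.adjoin F (Set.range u ∪ Set.range v) :=
  Algebra.subset_adjoin (Or.inr ⟨c, rfl⟩)

/-- The `2 × 2` permanents `w_ab = u_a v_b + u_b v_a` lie in `F[u,v]`. -/
theorem perTwo_mem_adjoin_rows (a b : Fin 4) :
    u a * v b + u b * v a ∈ Algebra.adjoin F (Set.range u ∪ Set.range v) :=
  Subalgebra.add_mem _ (Subalgebra.mul_mem _ (u_mem_adjoin_rows (F := F) u v a)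
    (v_mem_adjoin_rows (F := F) u v b))
    (Subalgebra.mul_mem _ (u_mem_adjoin_rows (F := F) u v b) (v_mem_adjoin_rows (F := F) u v a))

/-- **Solving `v_x` from `w_dx = 0`**: if `u_d ≠ 0` and `u_d v_x + u_x v_d = 0` then `v_x` is algebraic
over `F[u, v_d]`. [folklore] -/
theorem alg_v_of_perTwo_eq_zero {d x : Fin 4} (hud : u d ≠ 0) (h : u d * v x + u x * v d = 0) :
    IsAlgebraic (Algebra.adjoin F (Set.range u ∪ {v d})) (v x) := by
  refine alg_of_mul_eq (c := u d) (d := -(u x * v d)) (Algebra.subset_adjoin (Or.inl ⟨d, rfl⟩))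
    (Subalgebra.neg_mem _ (Subalgebra.mul_mem _ (Algebra.subset_adjoin (Or.inl ⟨x, rfl⟩))
      (Algebra.subset_adjoin (Or.inr rfl)))) hud ?_
  linear_combination h

/-- **STAR.**  If the three `2 × 2` permanents `w_dx` (`x ≠ d`) through a column `d` vanish and
`(u_d, v_d) ≠ (0,0)`, then `trdeg_F F[u,v] ≤ 5` (one row is proportional to a twist of the other).
[cite: Kirkup2005, Prop. 11] -/
theorem trdeg_le_five_of_star (d : Fin 4) (hstar : ∀ x, x ≠ d → u d * v x + u x * v d = 0)
    (hd : u d ≠ 0 ∨ v d ≠ 0) :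
    Algebra.trdeg F (Algebra.adjoin F (Set.range u ∪ Set.range v)) ≤ 5 := by
  classical
  rcases hd with hud | hvd
  · -- `v_x = -u_x v_d / u_d`: cover by `u` (4) and `v_d` (1)
    have h := trdeg_adjoin_le_of_cover_add (F := F) (U := Set.range u ∪ Set.range v)
      (T := Set.range u) (m := 4) (trdeg_adjoin_range_le u) ![v d] fun x hx => ?_
    · exact h.trans (by norm_num)
    · have hT : Set.range u ∪ Set.range ![v d] = Set.range u ∪ {v d} := by
        ext y; simp
      rw [hT]
      rcases hx with ⟨c, rfl⟩ | ⟨c, rfl⟩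
      · exact alg_of_mem (Or.inl ⟨c, rfl⟩)
      · by_cases hcd : c = d
        · subst hcd; exact alg_of_mem (Or.inr rfl)
        · exact alg_v_of_perTwo_eq_zero (F := F) u v hud (hstar c hcd)
  · -- symmetric: `u_x = -v_x u_d / v_d`
    have h := trdeg_adjoin_le_of_cover_add (F := F) (U := Set.range u ∪ Set.range v)
      (T := Set.range v) (m := 4) (trdeg_adjoin_range_le v) ![u d] fun x hx => ?_
    · exact h.trans (by norm_num)
    · have hT : Set.range v ∪ Set.range ![u d] = Set.range v ∪ {u d} := by
        ext y; simp
      rw [hT]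
      rcases hx with ⟨c, rfl⟩ | ⟨c, rfl⟩
      · by_cases hcd : c = d
        · subst hcd; exact alg_of_mem (Or.inr rfl)
        · have h' : v d * u c + v c * u d = 0 := by linear_combination hstar c hcd
          exact alg_v_of_perTwo_eq_zero (F := F) v u hvd h'
      · exact alg_of_mem (Or.inl ⟨c, rfl⟩)

/-- **All six `2 × 2` permanents zero** (`M(u,v) = 0`) with `u ≠ 0`, `v ≠ 0`: `trdeg_F F[u,v] ≤ 3`
(off the components `u = 0`, `v = 0` of `P_{2,4}` the supports shrink to a common pair of columns).
[cite: BoraleviCarliniMichalekVentura2025, Thm. 2.1] -/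
theorem trdeg_le_three_of_perTwo_all (h2 : (2 : L) ≠ 0)
    (hall : ∀ a b, a ≠ b → u a * v b + u b * v a = 0) (hu : ∃ c, u c ≠ 0) (hv : ∃ c, v c ≠ 0) :
    Algebra.trdeg F (Algebra.adjoin F (Set.range u ∪ Set.range v)) ≤ 3 := by
  classical
  obtain ⟨c, huc⟩ := hu
  -- `v_c ≠ 0`: otherwise all `v_x = 0`
  have hvc : v c ≠ 0 := by
    intro hvc
    obtain ⟨x, hvx⟩ := hv
    by_cases hxc : x = c
    · subst hxc; exact hvx hvc
    · have h := hall c x (Ne.symm hxc)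
      rw [hvc, mul_zero, add_zero] at h
      rcases mul_eq_zero.1 h with h' | h'
      · exact huc h'
      · exact hvx h'
  -- among the three other `u_x`, at most one is non-zero
  have hprod : ∀ x y, x ≠ c → y ≠ c → x ≠ y → u x * u y = 0 := by
    intro x y hxc hyc hxy
    have hx := hall c x (Ne.symm hxc)
    have hy := hall c y (Ne.symm hyc)
    have hxy' := hall x y hxy
    -- `u_c v_x = -u_x v_c`, `u_c v_y = -u_y v_c`; `u_x v_y + u_y v_x = 0`
    have key : u c * (u x * v y + u y * v x) = -(2 * (u x * u y * v c)) := by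
      linear_combination u y * hx + u x * hy
    rw [hxy', mul_zero] at key
    have : 2 * (u x * u y * v c) = 0 := by linear_combination key
    rcases mul_eq_zero.1 this with h' | h'
    · exact absurd h' h2
    · rcases mul_eq_zero.1 h' with h'' | h''
      · exact h''
      · exact absurd h'' hvc
  obtain ⟨x, y, w, hcx, hcy, hcw, hxy, hxw, hyw⟩ := exists_three_others c
  -- two of `u_x, u_y, u_w` vanish; cover by `u_c`, the remaining one, and `v_c`
  have hcover : ∀ keep : Fin 4, keep ≠ c → (∀ b, b ≠ c → b ≠ keep → u b = 0) →
      ∀ e ∈ Set.range u ∪ Set.range v,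
        IsAlgebraic (Algebra.adjoin F (Set.range ![u c, u keep, v c])) e := by
    intro keep hkeep hzero e he
    have hS : ∀ y ∈ Set.range u ∪ ({v c} : Set L),
        IsAlgebraic (Algebra.adjoin F (Set.range ![u c, u keep, v c])) y := by
      rintro y (⟨b, rfl⟩ | hy)
      · by_cases hbc : b = c
        · subst hbc; exact alg_of_mem ⟨0, by simp⟩
        · by_cases hbk : b = keep
          · subst hbk; exact alg_of_mem ⟨1, by simp⟩
          · exact alg_of_eq_zero _ (hzero b hbc hbk)
      · rw [Set.mem_singleton_iff] at hy
        subst hy; exact alg_of_mem ⟨2, by simp⟩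
    rcases he with ⟨b, rfl⟩ | ⟨b, rfl⟩
    · exact hS _ (Or.inl ⟨b, rfl⟩)
    · by_cases hbc : b = c
      · subst hbc; exact hS _ (Or.inr rfl)
      · exact alg_trans (alg_v_of_perTwo_eq_zero (F := F) u v huc (hall c b (Ne.symm hbc))) hS
  have hfin : ∀ keep : Fin 4, keep ≠ c → (∀ b, b ≠ c → b ≠ keep → u b = 0) →
      Algebra.trdeg F (Algebra.adjoin F (Set.range u ∪ Set.range v)) ≤ 3 := fun keep hk hz =>
    trdeg_adjoin_le_of_cover (F := F) _ (hcover keep hk hz)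
  -- case analysis: which of `u_x, u_y, u_w` survives
  by_cases hux : u x = 0
  · by_cases huy : u y = 0
    · refine hfin w hcw.symm fun b hbc hbw => ?_
      rcases eq_or_of_four c x y w hcx hcy hcw hxy hxw hyw b with rfl | rfl | rfl | rfl
      · exact absurd rfl hbc
      · exact hux
      · exact huy
      · exact absurd rfl hbw
    · have huw : u w = 0 := by
        have := hprod y w hcy.symm hcw.symm hyw
        rcases mul_eq_zero.1 this with h | h
        · exact absurd h huy
        · exact h
      refine hfin y hcy.symm fun b hbc hby => ?_
      rcases eq_or_of_four c x y w hcx hcy hcw hxy hxw hyw b with rfl | rfl | rfl | rfl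
      · exact absurd rfl hbc
      · exact hux
      · exact absurd rfl hby
      · exact huw
  · have huy : u y = 0 := by
      have := hprod x y hcx.symm hcy.symm hxy
      rcases mul_eq_zero.1 this with h | h
      · exact absurd h hux
      · exact h
    have huw : u w = 0 := by
      have := hprod x w hcx.symm hcw.symm hxw
      rcases mul_eq_zero.1 this with h | h
      · exact absurd h hux
      · exact h
    refine hfin x hcx.symm fun b hbc hbx => ?_
    rcases eq_or_of_four c x y w hcx hcy hcw hxy hxw hyw b with rfl | rfl | rfl | rfl
    · exact absurd rfl hbc
    · exact absurd rfl hbx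
    · exact huy
    · exact huw

/-- **MATCHING.**  Columns `{c,e} ⊔ {d,f} = [4]`; if `w_ce = w_df = 0`, `w_ef w_cd = w_cf w_de`, both
rows are non-zero and no column of `[u; v]` vanishes, then `trdeg_F F[u,v] ≤ 5` (`2 ≠ 0`).
[cite: Kirkup2005, Prop. 11] -/
theorem trdeg_le_five_of_matching (h2 : (2 : L) ≠ 0) {c d e f : Fin 4} (hcd : c ≠ d) (hce : c ≠ e)
    (hcf : c ≠ f) (hde : d ≠ e) (hdf : d ≠ f) (hef : e ≠ f)
    (hce0 : u c * v e + u e * v c = 0) (hdf0 : u d * v f + u f * v d = 0)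
    (hrel : (u e * v f + u f * v e) * (u c * v d + u d * v c) =
      (u c * v f + u f * v c) * (u d * v e + u e * v d))
    (hu : ∃ x, u x ≠ 0) (hcol : ∀ x, u x ≠ 0 ∨ v x ≠ 0) :
    Algebra.trdeg F (Algebra.adjoin F (Set.range u ∪ Set.range v)) ≤ 5 := by
  classical
  -- a cover by five of the eight coordinates suffices
  have cover5 : ∀ g : Fin 5 → L, (∀ x ∈ Set.range u ∪ Set.range v,
      IsAlgebraic (Algebra.adjoin F (Set.range g)) x) →
      Algebra.trdeg F (Algebra.adjoin F (Set.range u ∪ Set.range v)) ≤ 5 := fun g hg =>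
    trdeg_adjoin_le_of_cover (F := F) g hg
  -- membership helpers
  have four : ∀ b : Fin 4, b = c ∨ b = d ∨ b = e ∨ b = f :=
    eq_or_of_four c d e f hcd hce hcf hde hdf hef
  -- Case 1: `u_c ≠ 0` and `u_d ≠ 0`
  by_cases huc : u c = 0
  · -- `u_c = 0` forces `u_e = 0` (since `v_c ≠ 0`), then `u_d ≠ 0` solves `v_f`
    have hvc : v c ≠ 0 := by rcases hcol c with h | h; exact absurd huc h; exact h
    have hue : u e = 0 := by
      rw [huc, zero_mul, zero_add] at hce0
      rcases mul_eq_zero.1 hce0 with h | h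
      · exact h
      · exact absurd h hvc
    have hud : u d ≠ 0 := by
      intro hud
      have hvd : v d ≠ 0 := by rcases hcol d with h | h; exact absurd hud h; exact h
      have huf : u f = 0 := by
        rw [hud, zero_mul, zero_add] at hdf0
        rcases mul_eq_zero.1 hdf0 with h | h
        · exact h
        · exact absurd h hvd
      obtain ⟨x, hx⟩ := hu
      rcases four x with rfl | rfl | rfl | rfl
      · exact hx huc
      · exact hx hud
      · exact hx hue
      · exact hx huf
    -- cover: `u_d, u_f, v_c, v_d, v_e` (`u_c = u_e = 0`, `v_f` solved)
    refine cover5 ![u d, u f, v c, v d, v e] fun x hx => ?_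
    have hS : ∀ y ∈ Set.range u ∪ ({v d} : Set L),
        IsAlgebraic (Algebra.adjoin F (Set.range ![u d, u f, v c, v d, v e])) y := by
      rintro y (⟨b, rfl⟩ | hy)
      · rcases four b with rfl | rfl | rfl | rfl
        · exact alg_of_eq_zero _ huc
        · exact alg_of_mem ⟨0, by simp⟩
        · exact alg_of_eq_zero _ hue
        · exact alg_of_mem ⟨1, by simp⟩
      · rw [Set.mem_singleton_iff] at hy; subst hy
        exact alg_of_mem ⟨3, by simp⟩
    rcases hx with ⟨b, rfl⟩ | ⟨b, rfl⟩
    · exact hS _ (Or.inl ⟨b, rfl⟩)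
    · rcases four b with rfl | rfl | rfl | rfl
      · exact alg_of_mem ⟨2, by simp⟩
      · exact alg_of_mem ⟨3, by simp⟩
      · exact alg_of_mem ⟨4, by simp⟩
      · exact alg_trans (alg_v_of_perTwo_eq_zero (F := F) u v hud hdf0) hS
  · by_cases hud : u d = 0
    · -- symmetric to Case `u_c = 0`: `u_d = u_f = 0`, `u_c ≠ 0` solves `v_e`
      have hvd : v d ≠ 0 := by rcases hcol d with h | h; exact absurd hud h; exact h
      have huf : u f = 0 := by
        rw [hud, zero_mul, zero_add] at hdf0
        rcases mul_eq_zero.1 hdf0 with h | h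
        · exact h
        · exact absurd h hvd
      refine cover5 ![u c, u e, v d, v c, v f] fun x hx => ?_
      have hS : ∀ y ∈ Set.range u ∪ ({v c} : Set L),
          IsAlgebraic (Algebra.adjoin F (Set.range ![u c, u e, v d, v c, v f])) y := by
        rintro y (⟨b, rfl⟩ | hy)
        · rcases four b with rfl | rfl | rfl | rfl
          · exact alg_of_mem ⟨0, by simp⟩
          · exact alg_of_eq_zero _ hud
          · exact alg_of_mem ⟨1, by simp⟩
          · exact alg_of_eq_zero _ huf
        · rw [Set.mem_singleton_iff] at hy; subst hy
          exact alg_of_mem ⟨3, by simp⟩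
      rcases hx with ⟨b, rfl⟩ | ⟨b, rfl⟩
      · exact hS _ (Or.inl ⟨b, rfl⟩)
      · rcases four b with rfl | rfl | rfl | rfl
        · exact alg_of_mem ⟨3, by simp⟩
        · exact alg_of_mem ⟨2, by simp⟩
        · exact alg_trans (alg_v_of_perTwo_eq_zero (F := F) u v huc hce0) hS
        · exact alg_of_mem ⟨4, by simp⟩
    · -- Case `u_c ≠ 0`, `u_d ≠ 0`: `v_e`, `v_f` solved; the relation forces one more zero
      have key : 2 * 2 * (u e * u f * v c * v d) * (u c * u d) = 0 := by
        linear_combination (-(u c * u d)) * hrel +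
          (2 * u c * u d * u f * v d - u c * u d * (u d * v f + u f * v d)) * hce0 +
          (2 * u c * u d * u e * v c) * hdf0
      have key' : u e * u f * v c * v d = 0 := by
        rcases mul_eq_zero.1 key with h | h
        · rcases mul_eq_zero.1 h with h' | h'
          · rcases mul_eq_zero.1 h' with h'' | h''
            · exact absurd h'' h2
            · exact absurd h'' h2
          · exact h'
        · rcases mul_eq_zero.1 h with h' | h'
          · exact absurd h' huc
          · exact absurd h' hud
      -- `v_e, v_f` are algebraic over `F[u, v_c]` resp. `F[u, v_d]`
      have hve := alg_v_of_perTwo_eq_zero (F := F) u v huc hce0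
      have hvf := alg_v_of_perTwo_eq_zero (F := F) u v hud hdf0
      rcases mul_eq_zero.1 key' with h | hvd0
      · rcases mul_eq_zero.1 h with h' | hvc0
        · rcases mul_eq_zero.1 h' with hue0 | huf0
          · -- `u_e = 0` forces `v_e = 0`: a zero column, excluded
            exfalso
            have : u c * v e = 0 := by rw [hue0, zero_mul, add_zero] at hce0; exact hce0
            rcases mul_eq_zero.1 this with h'' | h''
            · exact huc h''
            · rcases hcol e with h3 | h3; exact h3 hue0; exact h3 h''
          · exfalso
            have : u d * v f = 0 := by rw [huf0, zero_mul, add_zero] at hdf0; exact hdf0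
            rcases mul_eq_zero.1 this with h'' | h''
            · exact hud h''
            · rcases hcol f with h3 | h3; exact h3 huf0; exact h3 h''
        · -- `v_c = 0`: cover by `u` (4) and `v_d`
          refine cover5 ![u c, u d, u e, u f, v d] fun x hx => ?_
          have hSu : ∀ y ∈ Set.range u,
              y ∈ Set.range ![u c, u d, u e, u f, v d] := by
            rintro y ⟨b, rfl⟩
            rcases four b with rfl | rfl | rfl | rfl
            · exact ⟨0, by simp⟩
            · exact ⟨1, by simp⟩
            · exact ⟨2, by simp⟩
            · exact ⟨3, by simp⟩
          have hSc : ∀ y ∈ Set.range u ∪ ({v c} : Set L),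
              IsAlgebraic (Algebra.adjoin F (Set.range ![u c, u d, u e, u f, v d])) y := by
            rintro y (hy | hy)
            · exact alg_of_mem (hSu y hy)
            · rw [Set.mem_singleton_iff] at hy; subst hy; exact alg_of_eq_zero _ hvc0
          have hSd : ∀ y ∈ Set.range u ∪ ({v d} : Set L),
              IsAlgebraic (Algebra.adjoin F (Set.range ![u c, u d, u e, u f, v d])) y := by
            rintro y (hy | hy)
            · exact alg_of_mem (hSu y hy)
            · rw [Set.mem_singleton_iff] at hy; subst hy; exact alg_of_mem ⟨4, by simp⟩
          rcases hx with hx | ⟨b, rfl⟩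
          · exact alg_of_mem (hSu x hx)
          · rcases four b with rfl | rfl | rfl | rfl
            · exact alg_of_eq_zero _ hvc0
            · exact alg_of_mem ⟨4, by simp⟩
            · exact alg_trans hve hSc
            · exact alg_trans hvf hSd
      · -- `v_d = 0`: cover by `u` (4) and `v_c`
        refine cover5 ![u c, u d, u e, u f, v c] fun x hx => ?_
        have hSu : ∀ y ∈ Set.range u,
            y ∈ Set.range ![u c, u d, u e, u f, v c] := by
          rintro y ⟨b, rfl⟩
          rcases four b with rfl | rfl | rfl | rfl
          · exact ⟨0, by simp⟩
          · exact ⟨1, by simp⟩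
          · exact ⟨2, by simp⟩
          · exact ⟨3, by simp⟩
        have hSc : ∀ y ∈ Set.range u ∪ ({v c} : Set L),
            IsAlgebraic (Algebra.adjoin F (Set.range ![u c, u d, u e, u f, v c])) y := by
          rintro y (hy | hy)
          · exact alg_of_mem (hSu y hy)
          · rw [Set.mem_singleton_iff] at hy; subst hy; exact alg_of_mem ⟨4, by simp⟩
        have hSd : ∀ y ∈ Set.range u ∪ ({v d} : Set L),
            IsAlgebraic (Algebra.adjoin F (Set.range ![u c, u d, u e, u f, v c])) y := by
          rintro y (hy | hy)
          · exact alg_of_mem (hSu y hy)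
          · rw [Set.mem_singleton_iff] at hy; subst hy; exact alg_of_eq_zero _ hvd0
        rcases hx with hx | ⟨b, rfl⟩
        · exact alg_of_mem (hSu x hx)
        · rcases four b with rfl | rfl | rfl | rfl
          · exact alg_of_mem ⟨4, by simp⟩
          · exact alg_of_eq_zero _ hvd0
          · exact alg_trans hve hSc
          · exact alg_trans hvf hSd

end LemmaA

end Summit.ValiantsHypothesis.ValiantsHypothesis.Theorems.PolyaContinuedLaplaceRigidity.SingCodim

end
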